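import Summits.BirchSwinnertonDyer.Rank1Residual.Additive.GordRamifiedOrdinaryLine
import Summits.BirchSwinnertonDyer.Rank1Residual.X2.GreenbergVatsalReductionDatumLine
import Summits.BirchSwinnertonDyer.Rank1Residual.X1.CongruenceTransfer
import HarnessLib

/-!
# TB-ROL FILE C: for a CONGRUENT PAIR of X4♯(G-ord) / X3♯(G-ord) rows, every `Γ_ℚ`-equivariant
# `E[p] ≃ E₁[p]` RESPECTS the ramified ordinary lines — the EPW "same `p`-stabilisation" clause is
# AUTOMATIC, so the whole per-pair line datum (`L`, `L₁`, line-respecting iso) of Route G's EPW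
# discharge follows from `TorsionIso W W₁ p` alone (team n1011, seat p10 gen 3, OWNERS row TB-ROL)

HONEST FRAMING (cell `b2b-bsdres`, run/shared/lean/b2b/bsd-rank1-residual/, verbatim in every
file): the goal of the cell is to DELETE the COMBINATION-SHAPED residual classes of the
Birch–Swinnerton-Dyer formula for ALL analytic-rank `≤ 1` elliptic curves over `ℚ` — "full BSD
formula for every rank `≤ 1` curve in class `C`" assembled STRICTLY from published theorems — so
that the rank-`≤ 1` remainder becomes exactly the CONSTRUCTION-SHAPED classes, which are TYPED
(missing-input `Prop`s), NOT attempted. This is not "finishing BSD". Team n1011 (N10/N11: X4 ∧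
`p = 3`): research route on the CONSTRUCTION-SHAPED class X4; prove what is provable now; no claim
beyond stated classes; census output = EVIDENCE / conjecture items, never a Literature fact;
X4♯(G-ord) stays CONSTRUCTION-SHAPED; RESIDUAL-MAP marks UNCHANGED; nothing is booked by this file.
Theorems only: NO definition, NO named fact, NO conjecture node. No hypothesis of a consumer is
silently dropped: two evidence-tier per-pair binders of `ClassX4Gord.mainConjecture_of_katoHalf_of_
coeffCert_of_epw` (the ramified ordinary lines `L`, `L₁` and the line-RESPECTING clause of `hiso`) are
PROVED from the remaining one (`TorsionIso W W₁ p`, GV Thm. (1.4)'s "`E[p] ≅ E₁[p]`") and the class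
binders of BOTH curves.

## What and why

EPW 2006 applies to two members of ONE Hida family `H(ρ̄)` with the SAME `p`-stabilisation (p. 3:
"a choice of one dimensional `G_{ℚ_p}`-invariant quotient"): on the curves, a `Γ_ℚ`-isomorphism
`ē : E[p] ≅ E₁[p]` carrying `C[p] = A'_{f̃,a}[p]` onto `C₁[p]`. Greenberg–Vatsal p. 26 observe (good
ordinary case) "since we are assuming that `p` is odd, the subgroup `C[p]` of `A[p]` is determined by
the action of `I_p`: `C[p] = μ_p`". The same mechanism decides the twisted case: for `E = V ⊗ χ`,
`E₁ = V₁ ⊗ χ` (`V`, `V₁` good ORDINARY at `p`, `χ = χ_d` quadratic, the SAME `d` for both — on the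
class `d = p*`), inertia acts on `C[p] = t(C_v(V)[p])` through `χ·ω` (`ω` = mod-`p` cyclotomic
character: `C_v(V)[p] ≅ μ_p` by the Weil pairing, tree
`X2.GreenbergVatsalReductionDatumLine.exists_generator_and_inertia_smul_eq_two`) and on
`E₁[p^∞]/C₁` through `χ` alone (`Ṽ₁[p^∞]` is unramified, `reductionDatum_htriv`). Take `σ₀ ∈ I_v`
with `ω(σ₀) = 2`: for `P ∈ C[p]`, `σ₀P = ±2P` (sign `χ(σ₀)`), hence `σ₀ ē(P) = ±2 ē(P)`, hence for
`y = t₁⁻¹(ē P) ∈ V₁[p]`: `σ₀ y = 2y` (the signs of `t`, `t₁` at `σ₀` agree — same `d`), so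
`y = σ₀y − y ∈ C_v(V₁)`, i.e. `ē(P) ∈ C₁`. Symmetrically with `ē⁻¹`. Hence:

* §1 `exists_mem_absInertia_smul_eq_two_nsmul` — `σ₀ ∈ I(ℚ̄_v/ℚ_v)` acting as `2` on `C_v(V)[p]`
  (from the X2 generator lemma; `p` odd, `V` good ordinary).
* §2 **`inclusion_mem_plus_of_equivariant`** (one direction) and
  **`inclusion_mem_plus_iff_of_equivariant`** (both): for transports `L = t(C_v(V))`,
  `L₁ = t₁(C_v(V₁))` (FILE A/B shape: `m ∈ L.plus ↔ t⁻¹m ∈ C_v(V)`) along isomorphisms `t`, `t₁`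
  that are equivariant where `σ√d = √d` and anti-equivariant where `σ√d = −√d`, and ANY
  `Γ_ℚ`-equivariant `ē : E[p] ≃+ E₁[p]`: `P ∈ L ⟺ ē(P) ∈ L₁` on `E[p]`.
* §3 **`exists_epwLineData_of_goodOrd_model_twist`**, **`ClassX4Gord.exists_epwLineData_of_torsionIso`**,
  **`ClassX3Gord.exists_epwLineData_of_torsionIso`** — for two `ℚ`-models `W = C • V^{(p*)}`,
  `W₁ = C₁ • V₁^{(p*)}` of `p*`-twists of good-ordinary curves (in particular two X4♯(G-ord) ∩ `I₀*`
  rows, or two X3♯(G-ord) ∩ `I₀*` rows, at the same odd `p`) and `TorsionIso W W₁ p`: there EXIST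
  ramified ordinary lines `L`, `L₁` at `v ∋ p` AND a `Γ_ℚ`-equivariant `E[p] ≃+ E₁[p]` respecting them
  — verbatim the hypothesis block (`hL`, `hL₁`, `hiso`) of cc-typer-1's cited EPW fact
  `muLambdaAlg_transfer_of_torsionIso_potOrd` and of Route G FILE 4.
What STAYS per pair: `TorsionIso W W₁ p` itself (GV Thm. (1.4) hypothesis; Kraus–Oesterlé /Sturm
certificate tier) and `Σ₀`. X4♯(G-ord) stays CONSTRUCTION-SHAPED; nothing booked.

References: Emerton–Pollack–Weston, Invent. Math. 163 (2006) p. 3 and §3.1 (arXiv math/0404484)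
[EmertonPollackWeston2006]; Greenberg–Vatsal, Invent. Math. 142 (2000) §2 p. 26 [GreenbergVatsal2000];
R. Greenberg, LNM 1716 (1999) §2 pp. 62–63, 69 [GreenbergLNM1716]; J. H. Silverman *AEC* III.8.1,
X.5 Cor. 5.4 [SilvermanAEC2009].
-/

set_option autoImplicit false

noncomputable section

open scoped Classical NumberField

open NumberField IsDedekindDomain Field WeierstrassCurve
  Literature.NumberTheory.GaloisRepresentations
  Literature.NumberTheory.EllipticCurves
  Literature.NumberTheory.EllipticCurves.Rank1Residual
  Literature.NumberTheory.EllipticCurves.GreenbergSelmer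
  Literature.NumberTheory.EllipticCurves.EmertonPollackWeston2006
  IsDedekindDomain.HeightOneSpectrum
  Summit.BirchSwinnertonDyer.Rank1Residual.X2
  Summit.BirchSwinnertonDyer.Rank1Residual.X2.GreenbergVatsalReductionDatum
open WeierstrassCurve (minimalDiscriminantInt integralModelInt)
open Summit.BirchSwinnertonDyer.Rank1Residual.X1.CongruenceTransfer (TorsionIso)

namespace Summit.BirchSwinnertonDyer.Rank1Residual.Additive

/-! ### §1 An inertia element acting as `2` on Greenberg's line `C_v[p]` -/

section Two

variable (V : WeierstrassCurve ℚ) [V.IsGloballyMinimal] [V.IsElliptic] (p : ℕ) [hp : Fact p.Prime]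
  {v : HeightOneSpectrum (𝓞 ℚ)}

/-- **`σ₀ ∈ I_v` acting as `2` on `C_v[p]`** (`V/ℚ` globally minimal, `p` odd good ordinary, `v ∋ p`):
the local inertia element with `χ_p(σ₀) = 2` of the tree's
`exists_generator_and_inertia_smul_eq_two` (`C_v[p] ≅ μ_p` as an `I_p`-module by the Weil pairing, GV
p. 26; local Kronecker–Weber) multiplies EVERY `m ∈ C_v` with `pm = 0` by `2` (such `m` map to
multiples of the generator `P₁`; `ι` is injective). [cite: GreenbergVatsal2000, §2 p. 26]
[cite: SilvermanAEC2009, Prop. III.8.1] -/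
theorem exists_mem_absInertia_smul_eq_two_nsmul (hp2 : p ≠ 2) (hpv : ((p : ℕ) : 𝓞 ℚ) ∈ v.asIdeal)
    (hΔ : ¬ (p : ℤ) ∣ minimalDiscriminantInt V) (hord : ¬ (p : ℤ) ∣ V.frobeniusTrace p) :
    ∃ σ₀ ∈ absInertia (v.adicCompletion ℚ), ∀ m ∈ (reductionDatum V p hpv hΔ).plus, p • m = 0 →
      absGaloisRestrict ℚ (v.adicCompletion ℚ) σ₀ • m = (2 : ℕ) • m := by
  obtain ⟨P₁, σ₀, -, -, hP₁gen, hσ₀I, hσ₀P₁⟩ :=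
    GreenbergVatsalReductionDatumLine.exists_generator_and_inertia_smul_eq_two V p hp2 hpv hΔ hord
  refine ⟨σ₀, hσ₀I, fun m hm hpm ↦ ?_⟩
  have hred : localRed V p hpv hΔ (pointsMap V (v.adicCompletion ℚ) (m : V.geomPoints)) = 0 :=
    (mem_reductionDatum_plus_iff V p hpv hΔ m).1 hm
  have hpm' : (p : ℤ) • pointsMap V (v.adicCompletion ℚ) (m : V.geomPoints) = 0 := by
    rw [natCast_zsmul, ← map_nsmul, ← AddSubmonoidClass.coe_nsmul, hpm, ZeroMemClass.coe_zero,
      map_zero]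
  obtain ⟨j, hj⟩ := hP₁gen _ hred hpm'
  apply GreenbergVatsalTateDatumCofree.pointsMap_coe_injective V p (v := v)
  change pointsMap V (v.adicCompletion ℚ)
      (((absGaloisRestrict ℚ (v.adicCompletion ℚ) σ₀ • m : V.geomPrimaryTorsion p)) : V.geomPoints) =
    pointsMap V (v.adicCompletion ℚ) ((((2 : ℕ) • m : V.geomPrimaryTorsion p)) : V.geomPoints)
  rw [primaryComponent.coe_smul, pointsMap_absGaloisRestrict_smul, hj, AddSubmonoidClass.coe_nsmul,
    map_nsmul, hj]
  have hσj : σ₀ • (j • P₁) = j • (σ₀ • P₁) :=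
    map_nsmul (DistribSMul.toAddMonoidHom (localPoints V (v.adicCompletion ℚ)) σ₀) j P₁
  rw [hσj, hσ₀P₁, smul_comm]

end Two

/-! ### §2 A `Γ_ℚ`-equivariant `E[p] ≃ E₁[p]` respects the transported lines -/

section Respect

variable (p : ℕ) [hp : Fact p.Prime] {v : HeightOneSpectrum (𝓞 ℚ)}

/-- **One direction: `P ∈ C ⟹ ē(P) ∈ C₁`.** `V`, `V₁` globally minimal, `p` odd, `v ∋ p`, `V` good
ORDINARY at `p` and `p ∤ Δ_{V₁}`; `d ∈ ℚ`; `t : V[p^∞] ≃+ W[p^∞]` and `t₁ : V₁[p^∞] ≃+ W₁[p^∞]`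
equivariant at `σ√d = √d` and anti-equivariant at `σ√d = −√d` (the SAME `d`); `L`, `L₁` transports of
Greenberg's data along `t`, `t₁`; `ē : W[p] ≃+ W₁[p]` `Γ_ℚ`-equivariant. Then for `P ∈ W[p]` with
`P ∈ L.plus`: `ē P ∈ L₁.plus`. Proof in the module docstring (`σ₀` with `ω(σ₀) = 2`; GV p. 26 "`C[p]`
is determined by the action of `I_p`"). [cite: GreenbergVatsal2000, §2 p. 26]
[cite: EmertonPollackWeston2006, p. 3 and §3.1 (arXiv:math/0404484)] -/
theorem inclusion_mem_plus_of_equivariant (hp2 : p ≠ 2)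
    (V V₁ : WeierstrassCurve ℚ) [V.IsElliptic] [V.IsGloballyMinimal] [V₁.IsElliptic]
    [V₁.IsGloballyMinimal] (hpv : ((p : ℕ) : 𝓞 ℚ) ∈ v.asIdeal)
    (hΔ : ¬ (p : ℤ) ∣ minimalDiscriminantInt V) (hord : ¬ (p : ℤ) ∣ V.frobeniusTrace p)
    (hΔ₁ : ¬ (p : ℤ) ∣ minimalDiscriminantInt V₁)
    {d : ℚ} {W W₁ : WeierstrassCurve ℚ}
    (t : ↥(V.geomPrimaryTorsion p) ≃+ ↥(W.geomPrimaryTorsion p))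
    (htpos : ∀ σ : absoluteGaloisGroup ℚ, σ • geomSqrt d = geomSqrt d → ∀ m, t (σ • m) = σ • t m)
    (htneg : ∀ σ : absoluteGaloisGroup ℚ, σ • geomSqrt d = -geomSqrt d → ∀ m, t (σ • m) = -(σ • t m))
    (t₁ : ↥(V₁.geomPrimaryTorsion p) ≃+ ↥(W₁.geomPrimaryTorsion p))
    (ht₁pos : ∀ σ : absoluteGaloisGroup ℚ, σ • geomSqrt d = geomSqrt d → ∀ m, t₁ (σ • m) = σ • t₁ m)
    (ht₁neg : ∀ σ : absoluteGaloisGroup ℚ, σ • geomSqrt d = -geomSqrt d →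
      ∀ m, t₁ (σ • m) = -(σ • t₁ m))
    (L : LocalDatum ℚ ↥(W.geomPrimaryTorsion p) v)
    (hL : ∀ m, m ∈ L.plus ↔ t.symm m ∈ (reductionDatum V p hpv hΔ).plus)
    (L₁ : LocalDatum ℚ ↥(W₁.geomPrimaryTorsion p) v)
    (hL₁ : ∀ m, m ∈ L₁.plus ↔ t₁.symm m ∈ (reductionDatum V₁ p hpv hΔ₁).plus)
    (ē : ↥(geomTorsion W (p : ℤ)) ≃+ ↥(geomTorsion W₁ (p : ℤ)))
    (hē : ∀ (σ : absoluteGaloisGroup ℚ) (P : ↥(geomTorsion W (p : ℤ))), ē (σ • P) = σ • ē P)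
    (P : ↥(geomTorsion W (p : ℤ)))
    (hP : AddSubgroup.inclusion (geomTorsion_le_geomPrimaryTorsion W p) P ∈ L.plus) :
    AddSubgroup.inclusion (geomTorsion_le_geomPrimaryTorsion W₁ p) (ē P) ∈ L₁.plus := by
  obtain ⟨σ₀, hσ₀I, hσ₀⟩ := exists_mem_absInertia_smul_eq_two_nsmul V p hp2 hpv hΔ hord
  set x := absGaloisRestrict ℚ (v.adicCompletion ℚ) σ₀ with hx
  have hxI : x ∈ inertia v := Subgroup.mem_map.2 ⟨σ₀, hσ₀I, rfl⟩
  set ιP := AddSubgroup.inclusion (geomTorsion_le_geomPrimaryTorsion W p) P with hιP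
  set ιR := AddSubgroup.inclusion (geomTorsion_le_geomPrimaryTorsion W₁ p) (ē P) with hιR
  -- `Q = t⁻¹ ιP ∈ C_v(V)` is `p`-torsion, so `x • Q = 2Q`
  have hQ : t.symm ιP ∈ (reductionDatum V p hpv hΔ).plus := (hL _).1 hP
  have hpιP : p • ιP = 0 := by rw [hιP, ← map_nsmul, AddSubgroup.torsionBy.nsmul, map_zero]
  have h2Q : x • t.symm ιP = (2 : ℕ) • t.symm ιP :=
    hσ₀ _ hQ (by rw [← map_nsmul, hpιP, map_zero])
  -- the scalar by which `x` acts on `ιP`, `P`, `ē P`, `ιR`: `2χ(x)`; then `y = t₁⁻¹ ιR` has `x•y = 2y`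
  have hy : x • t₁.symm ιR = (2 : ℕ) • t₁.symm ιR := by
    rcases map_geomSqrt (absoluteGaloisGroup.toAlgEquiv ℚ x) d with hs | hs
    · -- `χ(x) = 1`
      have h1 : x • ιP = (2 : ℕ) • ιP := by
        have h := htpos x hs (t.symm ιP)
        rw [t.apply_symm_apply] at h
        rw [← h, h2Q, map_nsmul, t.apply_symm_apply]
      have h2 : x • P = (2 : ℕ) • P := by
        apply AddSubgroup.inclusion_injective (geomTorsion_le_geomPrimaryTorsion W p)
        rw [map_nsmul]
        exact h1
      have h3 : x • ιR = (2 : ℕ) • ιR := by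
        have hc : x • ιR =
            AddSubgroup.inclusion (geomTorsion_le_geomPrimaryTorsion W₁ p) (x • ē P) :=
          Subtype.ext rfl
        rw [hc, ← hē, h2, map_nsmul, map_nsmul]
      apply t₁.injective
      rw [ht₁pos x hs, t₁.apply_symm_apply, h3, map_nsmul, t₁.apply_symm_apply]
    · -- `χ(x) = −1`
      have h1 : x • ιP = -((2 : ℕ) • ιP) := by
        have h := htneg x hs (t.symm ιP)
        rw [t.apply_symm_apply] at h
        rw [← neg_eq_iff_eq_neg] at h
        rw [← h, h2Q, map_nsmul, t.apply_symm_apply]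
      have h2 : x • P = -((2 : ℕ) • P) := by
        apply AddSubgroup.inclusion_injective (geomTorsion_le_geomPrimaryTorsion W p)
        rw [map_neg, map_nsmul]
        exact h1
      have h3 : x • ιR = -((2 : ℕ) • ιR) := by
        have hc : x • ιR =
            AddSubgroup.inclusion (geomTorsion_le_geomPrimaryTorsion W₁ p) (x • ē P) :=
          Subtype.ext rfl
        rw [hc, ← hē, h2, map_neg, map_nsmul, map_neg, map_nsmul]
      apply t₁.injective
      rw [ht₁neg x hs, t₁.apply_symm_apply, h3, neg_neg, map_nsmul, t₁.apply_symm_apply]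
  -- inertia acts trivially on `V₁[p^∞]/C_v(V₁)`: `y = x•y − y ∈ C_v(V₁)`
  have htriv := reductionDatum_htriv V₁ p hpv hΔ₁ x hxI (t₁.symm ιR)
  rw [hy, two_nsmul, add_sub_cancel_right] at htriv
  exact (hL₁ _).2 htriv

/-- **A `Γ_ℚ`-equivariant `E[p] ≃ E₁[p]` RESPECTS the ramified ordinary lines** (both directions; the
hypotheses are symmetric: both `V`, `V₁` good ordinary at the odd `p`, same `d`). This is EPW's "same
`p`-stabilisation" / Greenberg–Vatsal's "`C[p]` is determined by the action of `I_p`" for the twisted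
pair. [cite: GreenbergVatsal2000, §2 p. 26] [cite: EmertonPollackWeston2006, p. 3 and §3.1 (arXiv:math/0404484)] -/
theorem inclusion_mem_plus_iff_of_equivariant (hp2 : p ≠ 2)
    (V V₁ : WeierstrassCurve ℚ) [V.IsElliptic] [V.IsGloballyMinimal] [V₁.IsElliptic]
    [V₁.IsGloballyMinimal] (hpv : ((p : ℕ) : 𝓞 ℚ) ∈ v.asIdeal)
    (hΔ : ¬ (p : ℤ) ∣ minimalDiscriminantInt V) (hord : ¬ (p : ℤ) ∣ V.frobeniusTrace p)
    (hΔ₁ : ¬ (p : ℤ) ∣ minimalDiscriminantInt V₁) (hord₁ : ¬ (p : ℤ) ∣ V₁.frobeniusTrace p)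
    {d : ℚ} {W W₁ : WeierstrassCurve ℚ}
    (t : ↥(V.geomPrimaryTorsion p) ≃+ ↥(W.geomPrimaryTorsion p))
    (htpos : ∀ σ : absoluteGaloisGroup ℚ, σ • geomSqrt d = geomSqrt d → ∀ m, t (σ • m) = σ • t m)
    (htneg : ∀ σ : absoluteGaloisGroup ℚ, σ • geomSqrt d = -geomSqrt d → ∀ m, t (σ • m) = -(σ • t m))
    (t₁ : ↥(V₁.geomPrimaryTorsion p) ≃+ ↥(W₁.geomPrimaryTorsion p))
    (ht₁pos : ∀ σ : absoluteGaloisGroup ℚ, σ • geomSqrt d = geomSqrt d → ∀ m, t₁ (σ • m) = σ • t₁ m)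
    (ht₁neg : ∀ σ : absoluteGaloisGroup ℚ, σ • geomSqrt d = -geomSqrt d →
      ∀ m, t₁ (σ • m) = -(σ • t₁ m))
    (L : LocalDatum ℚ ↥(W.geomPrimaryTorsion p) v)
    (hL : ∀ m, m ∈ L.plus ↔ t.symm m ∈ (reductionDatum V p hpv hΔ).plus)
    (L₁ : LocalDatum ℚ ↥(W₁.geomPrimaryTorsion p) v)
    (hL₁ : ∀ m, m ∈ L₁.plus ↔ t₁.symm m ∈ (reductionDatum V₁ p hpv hΔ₁).plus)
    (ē : ↥(geomTorsion W (p : ℤ)) ≃+ ↥(geomTorsion W₁ (p : ℤ)))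
    (hē : ∀ (σ : absoluteGaloisGroup ℚ) (P : ↥(geomTorsion W (p : ℤ))), ē (σ • P) = σ • ē P) :
    ∀ P : ↥(geomTorsion W (p : ℤ)),
      AddSubgroup.inclusion (geomTorsion_le_geomPrimaryTorsion W p) P ∈ L.plus ↔
        AddSubgroup.inclusion (geomTorsion_le_geomPrimaryTorsion W₁ p) (ē P) ∈ L₁.plus := by
  have hē' : ∀ (σ : absoluteGaloisGroup ℚ) (Q : ↥(geomTorsion W₁ (p : ℤ))),
      ē.symm (σ • Q) = σ • ē.symm Q := fun σ Q ↦
    ē.injective (by rw [ē.apply_symm_apply, hē, ē.apply_symm_apply])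
  intro P
  refine ⟨inclusion_mem_plus_of_equivariant p hp2 V V₁ hpv hΔ hord hΔ₁ t htpos htneg t₁ ht₁pos ht₁neg
    L hL L₁ hL₁ ē hē P, fun h ↦ ?_⟩
  have h' := inclusion_mem_plus_of_equivariant p hp2 V₁ V hpv hΔ₁ hord₁ hΔ t₁ ht₁pos ht₁neg t htpos
    htneg L₁ hL₁ L hL ē.symm hē' (ē P) h
  rwa [ē.symm_apply_apply] at h'

end Respect

/-! ### §3 The whole EPW line datum of a congruent pair from `TorsionIso` alone -/

section Pair

variable (p : ℕ) [hp : Fact p.Prime] {v : HeightOneSpectrum (𝓞 ℚ)}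

/-- **The EPW per-pair line datum from `TorsionIso`, for two `ℚ`-models of `d`-twists of
good-ordinary curves.** `p` odd, `v ∋ p`, `d ∈ ℤ` with `ord_v d = 1`; `V`, `V₁` globally minimal,
good ordinary at `p`; `W = C • V^{(d)}`, `W₁ = C₁ • V₁^{(d)}` over `ℚ`; `TorsionIso W W₁ p`. THEN there
are ramified ordinary lines `L` (of `W`) and `L₁` (of `W₁`) at `v` and a `Γ_ℚ`-equivariant
`ē : W[p] ≃+ W₁[p]` with `P ∈ L ⟺ ē P ∈ L₁` — the hypothesis block (`hL`, `hL₁`, `hiso`) of the cited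
EPW fact `muLambdaAlg_transfer_of_torsionIso_potOrd`. (FILE B gives the lines; §2 the respecting.)
[cite: EmertonPollackWeston2006, p. 3 and §3.1 (eq:ordes) (arXiv:math/0404484 p. 17)]
[cite: GreenbergVatsal2000, §2 p. 26] [cite: GreenbergLNM1716, §2 pp. 62–63 and p. 69] -/
theorem exists_epwLineData_of_goodOrd_model_twist (hp2 : p ≠ 2)
    (V V₁ : WeierstrassCurve ℚ) [V.IsElliptic] [V.IsGloballyMinimal] [V₁.IsElliptic]
    [V₁.IsGloballyMinimal] (hpv : ((p : ℕ) : 𝓞 ℚ) ∈ v.asIdeal)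
    (hΔ : ¬ (p : ℤ) ∣ minimalDiscriminantInt V) (hord : ¬ (p : ℤ) ∣ V.frobeniusTrace p)
    (hΔ₁ : ¬ (p : ℤ) ∣ minimalDiscriminantInt V₁) (hord₁ : ¬ (p : ℤ) ∣ V₁.frobeniusTrace p)
    {d : ℤ} (hd : v.intValuation (d : 𝓞 ℚ) = WithZero.exp (-1 : ℤ))
    {W W₁ : WeierstrassCurve ℚ} (hCW : ∃ C : VariableChange ℚ, C • V.quadraticTwist (d : ℚ) = W)
    (hCW₁ : ∃ C₁ : VariableChange ℚ, C₁ • V₁.quadraticTwist (d : ℚ) = W₁) (hT : TorsionIso W W₁ p) :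
    ∃ (L : LocalDatum ℚ ↥(W.geomPrimaryTorsion p) v) (L₁ : LocalDatum ℚ ↥(W₁.geomPrimaryTorsion p) v),
      IsRamifiedOrdinaryLine W p L ∧ IsRamifiedOrdinaryLine W₁ p L₁ ∧
      ∃ e : ↥(geomTorsion W (p : ℤ)) ≃+ ↥(geomTorsion W₁ (p : ℤ)),
        (∀ (σ : absoluteGaloisGroup ℚ) (P : ↥(geomTorsion W (p : ℤ))), e (σ • P) = σ • e P) ∧
        (∀ P : ↥(geomTorsion W (p : ℤ)),
          AddSubgroup.inclusion (geomTorsion_le_geomPrimaryTorsion W p) P ∈ L.plus ↔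
            AddSubgroup.inclusion (geomTorsion_le_geomPrimaryTorsion W₁ p) (e P) ∈ L₁.plus) := by
  have hd0 : (d : ℚ) ≠ 0 := by
    intro h
    have hdz : (d : 𝓞 ℚ) = 0 := by exact_mod_cast (Int.cast_eq_zero.1 h)
    rw [hdz, map_zero] at hd
    exact WithZero.zero_ne_coe hd
  haveI : NeZero (2 : ℚ) := ⟨two_ne_zero⟩
  obtain ⟨t, ht, htpos, htneg⟩ := exists_addEquiv_geomPrimaryTorsion_of_model_twist_sign p V hd0 hCW
  obtain ⟨t₁, ht₁, ht₁pos, ht₁neg⟩ :=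
    exists_addEquiv_geomPrimaryTorsion_of_model_twist_sign p V₁ hd0 hCW₁
  obtain ⟨L, hL⟩ := exists_localDatum_transport (reductionDatum V p hpv hΔ) t ht
  obtain ⟨L₁, hL₁⟩ := exists_localDatum_transport (reductionDatum V₁ p hpv hΔ₁) t₁ ht₁
  obtain ⟨ē, hē⟩ := hT
  exact ⟨L, L₁,
    isRamifiedOrdinaryLine_of_transport_reductionDatum p hp2 V hpv hΔ hord hd t ht htneg L hL,
    isRamifiedOrdinaryLine_of_transport_reductionDatum p hp2 V₁ hpv hΔ₁ hord₁ hd t₁ ht₁ ht₁neg L₁ hL₁,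
    ē, hē, inclusion_mem_plus_iff_of_equivariant p hp2 V V₁ hpv hΔ hord hΔ₁ hord₁ t htpos htneg t₁
      ht₁pos ht₁neg L hL L₁ hL₁ ē hē⟩

/-- **The `p*`-twist model form** (the cell's binders `C • V^{(p*)} = W`, `GoodOrd V p` for BOTH
members of the pair). [cite: EmertonPollackWeston2006, p. 3 and §3.1 (eq:ordes) (arXiv:math/0404484 p. 17)]
[cite: GreenbergVatsal2000, §2 p. 26] -/
theorem exists_epwLineData_of_goodOrd_pStar_twist (hp2 : p ≠ 2)
    (V V₁ : WeierstrassCurve ℚ) [V.IsElliptic] [V.IsGloballyMinimal] [V₁.IsElliptic]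
    [V₁.IsGloballyMinimal] {W W₁ : WeierstrassCurve ℚ}
    (hCW : ∃ C : VariableChange ℚ, C • V.quadraticTwist ((-1 : ℚ) ^ (p / 2) * p) = W)
    (hCW₁ : ∃ C₁ : VariableChange ℚ, C₁ • V₁.quadraticTwist ((-1 : ℚ) ^ (p / 2) * p) = W₁)
    (hV : GoodOrd V p) (hV₁ : GoodOrd V₁ p) (hT : TorsionIso W W₁ p)
    (hpv : ((p : ℕ) : 𝓞 ℚ) ∈ v.asIdeal) :
    ∃ (L : LocalDatum ℚ ↥(W.geomPrimaryTorsion p) v) (L₁ : LocalDatum ℚ ↥(W₁.geomPrimaryTorsion p) v),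
      IsRamifiedOrdinaryLine W p L ∧ IsRamifiedOrdinaryLine W₁ p L₁ ∧
      ∃ e : ↥(geomTorsion W (p : ℤ)) ≃+ ↥(geomTorsion W₁ (p : ℤ)),
        (∀ (σ : absoluteGaloisGroup ℚ) (P : ↥(geomTorsion W (p : ℤ))), e (σ • P) = σ • e P) ∧
        (∀ P : ↥(geomTorsion W (p : ℤ)),
          AddSubgroup.inclusion (geomTorsion_le_geomPrimaryTorsion W p) P ∈ L.plus ↔
            AddSubgroup.inclusion (geomTorsion_le_geomPrimaryTorsion W₁ p) (e P) ∈ L₁.plus) := by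
  have hCW' : ∃ C : VariableChange ℚ,
      C • V.quadraticTwist ((((-1 : ℤ) ^ (p / 2) * p : ℤ)) : ℚ) = W := by
    push_cast; exact hCW
  have hCW₁' : ∃ C₁ : VariableChange ℚ,
      C₁ • V₁.quadraticTwist ((((-1 : ℤ) ^ (p / 2) * p : ℤ)) : ℚ) = W₁ := by
    push_cast; exact hCW₁
  exact exists_epwLineData_of_goodOrd_model_twist p hp2 V V₁ hpv
    (V.not_dvd_minimalDiscriminantInt_of_hasGoodReductionAtPrime' p hV.1) hV.2
    (V₁.not_dvd_minimalDiscriminantInt_of_hasGoodReductionAtPrime' p hV₁.1) hV₁.2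
    (intValuation_pStar p hpv) hCW' hCW₁' hT

variable {p} {W W₁ : WeierstrassCurve ℚ} [W.IsElliptic] [W.IsGloballyMinimal] [W₁.IsElliptic]
  [W₁.IsGloballyMinimal]

/-- **Two X4♯(G-ord) ∩ `I₀*` rows at the same odd `p` with `E[p] ≅ E₁[p]`: the EPW line datum EXISTS**
— ramified ordinary lines `L`, `L₁` at `v ∋ p` and a `Γ_ℚ`-equivariant `E[p] ≃+ E₁[p]` respecting
them, from `TorsionIso W W₁ p` and the class binders alone. These are the binders `hL`, `hL₁`, `hiso`
of Route G FILE 4 (`ClassX4Gord.mainConjecture_of_katoHalf_of_coeffCert_of_epw`); `TorsionIso` and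
`Σ₀` stay per pair. X4♯(G-ord) stays CONSTRUCTION-SHAPED; nothing booked.
[cite: EmertonPollackWeston2006, p. 3 and §3.1 (eq:ordes) (arXiv:math/0404484 p. 17)]
[cite: GreenbergVatsal2000, Thm. (1.4) and §2 p. 26] -/
theorem ClassX4Gord.exists_epwLineData_of_torsionIso (hX : ClassX4Gord W p)
    (he : semistabilityIndex W p = 2) (hX₁ : ClassX4Gord W₁ p) (he₁ : semistabilityIndex W₁ p = 2)
    (hT : TorsionIso W W₁ p) (hpv : ((p : ℕ) : 𝓞 ℚ) ∈ v.asIdeal) :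
    ∃ (L : LocalDatum ℚ ↥(W.geomPrimaryTorsion p) v) (L₁ : LocalDatum ℚ ↥(W₁.geomPrimaryTorsion p) v),
      IsRamifiedOrdinaryLine W p L ∧ IsRamifiedOrdinaryLine W₁ p L₁ ∧
      ∃ e : ↥(geomTorsion W (p : ℤ)) ≃+ ↥(geomTorsion W₁ (p : ℤ)),
        (∀ (σ : absoluteGaloisGroup ℚ) (P : ↥(geomTorsion W (p : ℤ))), e (σ • P) = σ • e P) ∧
        (∀ P : ↥(geomTorsion W (p : ℤ)),
          AddSubgroup.inclusion (geomTorsion_le_geomPrimaryTorsion W p) P ∈ L.plus ↔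
            AddSubgroup.inclusion (geomTorsion_le_geomPrimaryTorsion W₁ p) (e P) ∈ L₁.plus) := by
  obtain ⟨V, _, _, C, hord, hC⟩ := ClassX4Gord.exists_goodOrd_pStar_twist_model W p hX he
  obtain ⟨V₁, _, _, C₁, hord₁, hC₁⟩ := ClassX4Gord.exists_goodOrd_pStar_twist_model W₁ p hX₁ he₁
  exact exists_epwLineData_of_goodOrd_pStar_twist p hX.addv.1 V V₁ ⟨C, hC⟩ ⟨C₁, hC₁⟩ hord hord₁ hT hpv

/-- **Two X3♯(G-ord) ∩ `I₀*` rows at the same odd `p` with `E[p] ≅ E₁[p]`: the EPW line datum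
EXISTS** (same construction). Nothing booked. [cite: EmertonPollackWeston2006, p. 3 and §3.1 (eq:ordes) (arXiv:math/0404484 p. 17)]
[cite: GreenbergVatsal2000, Thm. (1.4) and §2 p. 26] -/
theorem ClassX3Gord.exists_epwLineData_of_torsionIso (hp2 : p ≠ 2) (hX : ClassX3Gord W p)
    (he : semistabilityIndex W p = 2) (hX₁ : ClassX3Gord W₁ p) (he₁ : semistabilityIndex W₁ p = 2)
    (hT : TorsionIso W W₁ p) (hpv : ((p : ℕ) : 𝓞 ℚ) ∈ v.asIdeal) :
    ∃ (L : LocalDatum ℚ ↥(W.geomPrimaryTorsion p) v) (L₁ : LocalDatum ℚ ↥(W₁.geomPrimaryTorsion p) v),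
      IsRamifiedOrdinaryLine W p L ∧ IsRamifiedOrdinaryLine W₁ p L₁ ∧
      ∃ e : ↥(geomTorsion W (p : ℤ)) ≃+ ↥(geomTorsion W₁ (p : ℤ)),
        (∀ (σ : absoluteGaloisGroup ℚ) (P : ↥(geomTorsion W (p : ℤ))), e (σ • P) = σ • e P) ∧
        (∀ P : ↥(geomTorsion W (p : ℤ)),
          AddSubgroup.inclusion (geomTorsion_le_geomPrimaryTorsion W p) P ∈ L.plus ↔
            AddSubgroup.inclusion (geomTorsion_le_geomPrimaryTorsion W₁ p) (e P) ∈ L₁.plus) := by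
  obtain ⟨V, _, _, C, hord, hC⟩ := ClassX3Gord.exists_goodOrd_pStar_twist_model W p hp2 hX he
  obtain ⟨V₁, _, _, C₁, hord₁, hC₁⟩ := ClassX3Gord.exists_goodOrd_pStar_twist_model W₁ p hp2 hX₁ he₁
  exact exists_epwLineData_of_goodOrd_pStar_twist p hp2 V V₁ ⟨C, hC⟩ ⟨C₁, hC₁⟩ hord hord₁ hT hpv

end Pair

end Summit.BirchSwinnertonDyer.Rank1Residual.Additive

end
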